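import Summits.BirchSwinnertonDyer.Rank1Residual.O5.HeegnerLogTransportThreeResidualEndFacts
import Summits.BirchSwinnertonDyer.Rank1Residual.O5.HeegnerLogTransportThreeKrizLiGlue
import HarnessLib
import HarnessLib.Audit.Tags

/-!
# O5 (t′) — KL3 part 15: the END of record with KL3-A discharged by the cited fact (Kriz–Li Thm. 1.16)

Research route (cell `b2b-bsdres`, class O5 = tame potentially-supersingular additive `p = 3` (t′));
**honest framing**: a CONDITIONAL theorem whose displayed inputs are published theorems vendored as named
facts + per-pair census binders; nothing booked, no mark / label / count / tier of `RESIDUAL-MAP.md` moves,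
census = EVIDENCE (never a Literature fact); O5 stays OPEN as a class.

`o5_index_unit_of_ordinary_companion_cited` = part 9's END `o5_index_unit_of_ordinary_companion_facts`
with its first binder `hA : KrizLiUnitBitTransportThree` (the cell's own typed node KL3-A) REPLACED by
`hKL : KrizLi2019.thm116_padicLogHeegner_congruence` (Kriz–Li, *FMS* 7 (2019) e15, Thm. 1.16 AS PRINTED,
`m = 1`; the literature registry's named fact, lit GEN 90) — via part 14's
`krizLiUnitBitTransportThree_of_thm116_of_exists_isNewformOf hKL hmod` (the level-to-conductor step is
the tree's proved Carayol-from-modularity theorem, `hmod` is already displayed). After this file the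
`W`-side path of the KL3 chain carries NO typed node of the cell: the displayed named facts are
{Kriz–Li 1.16, Poitou–Tate, local Euler–Poincaré, Yan–Zhu A10, Wuthrich L20, modularity, GZ+Kolyvagin
rank theorem, Kolyvagin (for `W` and `G`), Gross–Zagier (for `G`)}; everything else is a per-pair census
binder (companion `G`, congruence off `3NN′`, unit Euler-type factors at `ℓ ≠ 3`, Tamagawa / Manin /
torsion side conditions, Heegner field data, `Ш(W/K)[3^∞]` trivial, the STEP-0 identity for `(G, G^{d_K})`).
[cite: KrizLi2019, Thm. 1.16, Rem. 1.17 (FMS 7 (2019) e15)]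

## TYPER PLACEMENT NOTE (cc-typer-5 GEN 18 = O5 §3.5 / O6 §3.4 typer of record; by-name ask A-O5-G21-1 addendum (e) of o5-r2 GEN 21 ADDENDUM 4, HOME/INBOX.md l.14114;
cc-lead GEN 77 l.14166 'parts 14 / 15 ADMISSIBLE after p350088 is built + 9 placed')

Source: `HOME/b2b-bsdres-o5-r2/gen21/lean/HeegnerLogTransportThreeCitedEnd.lean` sha16 `44495c311fe0dc77` (99 l.; `gen21/SHA16.txt`; o5-r2's checks: `scratch_p14_inline.lean` e84ef370df54a660 rc 0 / 0 warnings,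
`scratch_p14_axioms.lean` dd833d4a1d50a634 axioms ×5 std, `scratch_p8_10ab_9_14_15_tree.lean` 1eac65a325584ba8 rc 0, axioms of `o5_index_unit_of_ordinary_companion_cited` std),
re-hashed by the typer right before writing; THIS file = KL3 part 15 = the source VERBATIM + this paragraph (imports, module text, every declaration block byte-identical;
script `class-closure/typer-5/gen18/g21e_place.py`, which also asserts that the tree's `Literature/NumberTheory/EllipticCurves/KrizLi2019/HeegnerLogCongruence.lean` is
p350088's 23986c2bbd5a491a (lit GEN 90, ACCEPTED 0cc14a4fe2bd; CITED-FACTS §A A314 `KrizLi2019.thm116_padicLogHeegner_congruence`, REFEREE 2 R2-127.3 CONFORMANT) — so no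
re-sync of §4 is needed); the typer's own farm check + DEDUP (`lean search --decl` on the new names: no match) precede the proposal.
CONTENT LABELS (source, unchanged): THEOREMS ONLY — 0 `def`, 0 `@[conjecture]`, 0 NEW Literature facts (net named-fact debt 0), no `sorry`; the published inputs stay displayed
hypotheses by NAME — here Kriz–Li Thm. 1.16 enters as the REGISTERED Literature fact `(h : KrizLi2019.thm116_padicLogHeegner_congruence)` and modularity as `exists_isNewformOf`;
KL3-A `KrizLiUnitBitTransportThree` (part 1, p340741) is NOT re-worded in place (append-only): part 14 PROVES it from {A314, modularity}, part 15 re-displays part 9's END with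
`hA` replaced by `hKL`.  Its docstring restamp in part 1 ('THEOREM modulo the cited fact A314 + modularity', citing part 14's pid) is a separate DOC-ONLY touch, docketed.
KL3 parts in the tree: 1–3 p340741 / p341262 / p341640, Global p342632, OrdCompanion p343587 + p344465, OrdSelmer p345030 + p345686, OrdTwist p346273, Residual Engine p347366 +
Residual p348865 + End p350277, BaseSelmer p349318, ExactCount p349954, GoodSelmer p350559, TameTamagawa p350983, RatLogUnit p351404 (+ ResidualEndFacts / BaseSelmerCount,
this seat), Literature index lemma p344022, Literature A314 p350088.  HONEST FRAMING (cell `b2b-bsdres`): research route, lane CLASS-CLOSURE §3.5 O5; a CONDITIONAL theorem —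
nothing asserted beyond the displayed binders, nothing booked, no mark of `RESIDUAL-MAP.md` moves; census = EVIDENCE, never a Literature fact; O5 OPEN.
-/

noncomputable section

open scoped Classical

open WeierstrassCurve Literature.NumberTheory.EllipticCurves
  Literature.NumberTheory.EllipticCurves.ModularForms
  Literature.NumberTheory.EllipticCurves.Rank1Residual
  Literature.NumberTheory.EllipticCurves.Rank1Residual.Typed
open Summit.BirchSwinnertonDyer.Rank1Residual.X11b (embAt)
open IsDedekindDomain (HeightOneSpectrum)
open Literature.NumberTheory.GaloisCohomology (poitouTate_selmerStructure_duality)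
open Literature.NumberTheory.GaloisRepresentations (localEulerPoincareCharacteristic)
open scoped NumberField

namespace Summit.BirchSwinnertonDyer.Rank1Residual.O5.HeegnerLogTransport

/-- **O5 (t′) END of record, cited form.** For `W` additive potentially supersingular at `3` with a
`3`-congruent good-ordinary companion `G` and the displayed per-pair data, the `3`-part of the Heegner
index `[W(K) : ℤP]` is trivial — ASSUMING ONLY published theorems (named facts by NAME: Kriz–Li Thm. 1.16
`hKL`, Poitou–Tate `hPT`, local Euler–Poincaré `hEP`, Yan–Zhu `hYZ`, Wuthrich `hW20`, modularity `hmod`,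
GZ+Kolyvagin `hGZK`, Kolyvagin `hKoW hKoG`, Gross–Zagier `hGZG`) and census-shaped binders. Part 9's END
with `hA := krizLiUnitBitTransportThree_of_thm116_of_exists_isNewformOf hKL hmod`.
[cite: KrizLi2019, Thm. 1.16, Rem. 1.17 (FMS 7 (2019) e15)] -/
theorem o5_index_unit_of_ordinary_companion_cited
    (hKL : KrizLi2019.thm116_padicLogHeegner_congruence)
    (hPT : ∀ (K : Type) [Field K] [NumberField K], poitouTate_selmerStructure_duality K)
    (hEP : ∀ (K : Type) [Field K] [NumberField K] (v : HeightOneSpectrum (𝓞 K)),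
      localEulerPoincareCharacteristic (v.adicCompletion K))
    (hYZ : YanZhu2026.thm415_padicValRat_bsd_rank_le_one)
    (hW20 : Wuthrich2014.lemma20_surjective_threeAdic_of_semistable)
    (hmod : exists_isNewformOf) (hGZK : rank_eq_analyticRank_of_analyticRank_le_one)
    (W G : WeierstrassCurve ℚ) [W.IsElliptic] [W.IsGloballyMinimal] [G.IsElliptic] [G.IsGloballyMinimal]
    (hcong : ∀ ℓ : ℕ, ℓ.Prime → ¬ (ℓ ∣ 3 * W.conductorNorm ℤ * G.conductorNorm ℤ) →
      ((W.LFunction ℓ : ℤ) : ZMod 3) = ((G.LFunction ℓ : ℤ) : ZMod 3))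
    (hρ : W.HasSurjectiveModNGaloisRep 3) (hadd : Addv W 3) (ht3 : NoLocalThreeTorsionAt W 3)
    (htℓ : ∀ (ℓ : ℕ) [Fact ℓ.Prime], ℓ ≠ 3 → (ℓ : ℤ) ∣ W.conductorNorm ℤ * G.conductorNorm ℤ →
      NoLocalThreeTorsionAt W ℓ)
    (hunitW : ∀ ℓ ∈ klSet W G, ℓ ≠ 3 → padicValInt 3 (nsCount W ℓ) = 0)
    (hunitG : ∀ ℓ ∈ klSet G W, ℓ ≠ 3 → padicValInt 3 (nsCount G ℓ) = 0)
    (htam : ¬ 3 ∣ W.tamagawaProduct) (htamG : ¬ 3 ∣ G.tamagawaProduct) (hordG : GoodOrd G 3)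
    (Gd : WeierstrassCurve ℚ) [Gd.IsElliptic] [Gd.IsGloballyMinimal]
    {N N' : ℕ} [NeZero N] [NeZero N'] (D : ModularParametrizationData W N)
    (D' : ModularParametrizationData G N')
    (K : Type) [Field K] [NumberField K] (hK : IsImaginaryQuadratic K)
    (hH : SatisfiesHeegnerHypothesis N K) (hH' : SatisfiesHeegnerHypothesis N' K)
    (hKoW : kolyvagin N W K) (hKoG : kolyvagin N' G K) (hGZG : gross_zagier N' G K)
    (hd : NumberField.discr K < -4) (h3d : ¬ ((3 : ℤ) ∣ NumberField.discr K))
    (hGd : ∃ C : VariableChange ℚ, C • G.quadraticTwist (NumberField.discr K : ℚ) = Gd)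
    (H : HeegnerDatum N (NumberField.discr K)) (H' : HeegnerDatum N' (NumberField.discr K))
    (ι : K →+* ℂ) (𝔭 : HeightOneSpectrum (𝓞 K)) (h𝔭 : ((3 : ℕ) : 𝓞 K) ∈ 𝔭.asIdeal)
    (he : 𝔭.asIdeal.ramificationIdx (𝓞 ℚ) = 1) (hf : 𝔭.asIdeal.inertiaDeg (𝓞 ℚ) = 1)
    (P : (W.baseChange K).toAffine.Point) (P' : (G.baseChange K).toAffine.Point)
    (hP : WeierstrassCurve.Affine.Point.map ι.toRatAlgHom P = heegnerPointComplex D H)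
    (hP' : WeierstrassCurve.Affine.Point.map ι.toRatAlgHom P' = heegnerPointComplex D' H')
    (hPinf : ¬ IsOfFinAddOrder P) (hP'inf : ¬ IsOfFinAddOrder P')
    (hshaW : Nat.card (AddCommGroup.primaryComponent (W.baseChange K).sha 3) = 1)
    (hQW : ∃ Q : (W.baseChange K).toAffine.Point, ¬ IsOfFinAddOrder Q ∧
      X11b.padicLogOrd W 3 (embAt K 3 𝔭 h𝔭 he hf) Q = 0)
    (hcD : padicValInt 3 D.maninConstant = 0) (hcD' : padicValInt 3 D'.maninConstant = 0)
    {q₀ q₁ : ℚ} (hq₀ : shaAn G = (q₀ : ℂ)) (hq₁ : shaAn Gd = (q₁ : ℂ))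
    (hstep0 : padicValRat 3 q₀ + padicValRat 3 q₁ + ((2 * padicValNat 3 G.tamagawaProduct : ℕ) : ℤ) +
        ((2 * padicValInt 3 D'.maninConstant : ℕ) : ℤ) =
      ((2 * padicValNat 3 (AddSubgroup.zmultiples P').index : ℕ) : ℤ)) :
    padicValNat 3 (AddSubgroup.zmultiples P).index = 0 :=
  o5_index_unit_of_ordinary_companion_facts
    (krizLiUnitBitTransportThree_of_thm116_of_exists_isNewformOf hKL hmod) hPT hEP hYZ hW20 hmod hGZK W G
    hcong hρ hadd ht3 htℓ hunitW hunitG htam htamG hordG Gd D D' K hK hH hH' hKoW hKoG hGZG hd h3d hGd H H'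
    ι 𝔭 h𝔭 he hf P P' hP hP' hPinf hP'inf hshaW hQW hcD hcD' hq₀ hq₁ hstep0

end Summit.BirchSwinnertonDyer.Rank1Residual.O5.HeegnerLogTransport

end
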